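import Mathlib.Analysis.CStarAlgebra.Matrix
import Mathlib.LinearAlgebra.Matrix.Block
import Literature.Analysis.OperatorTheory.ContractiveDetComplexity
import HarnessLib

/-!
# Crux `PriceOfContractivity` (stmt-ValiantsHypothesis-10583), line `birth` — partial case
`stub_sameSize_upperTriangular`

For an upper-triangular `K₀` the Sylvester pencil `1 + diagonal (X ∘ κ) * K₀.map C` is upper
triangular with diagonal entries `1 + X (κ i) * C (K₀ i i)`, so its determinant is
`∏ i, (1 + X (κ i) * C (K₀ i i))`.  Zero-freeness on the closed radius-2 polydisc, tested at the
constant points `z ≡ -(K₀ i i)⁻¹`, forces `‖K₀ i i‖ ≤ 1 / 2`; the diagonal matrix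
`K₁ := diagonal (fun i => K₀ i i)` with the same colouring has the same pencil determinant and
operator norm `max ‖K₀ i i‖ ≤ 1 / 2`.
-/

-- single-conjunct layout: Sub = Summit, duplicated namespace component intended
set_option linter.dupNamespace false

namespace Summit.ValiantsHypothesis.ValiantsHypothesis.Theorems.PriceOfContractivity.UpperTriangular

open MvPolynomial Matrix
open scoped Matrix.Norms.L2Operator

/-- The Sylvester pencil `1 + diagonal (X ∘ κ) * K.map C` of an upper-triangular matrix `K` is
upper triangular, so its determinant is the product of its diagonal entries
`1 + X (κ i) * C (K i i)`. [folklore] -/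
theorem det_pencil_of_upperTriangular {R : ℕ} {σ : Type} (K : Matrix (Fin R) (Fin R) ℂ)
    (κ : Fin R → σ) (hK : ∀ i j : Fin R, j < i → K i j = 0) :
    (1 + Matrix.diagonal (fun i => MvPolynomial.X (κ i)) *
        K.map (fun a : ℂ => (MvPolynomial.C a : MvPolynomial σ ℂ))).det =
      ∏ i, (1 + MvPolynomial.X (κ i) * MvPolynomial.C (K i i)) := by
  rw [Matrix.det_of_upperTriangular]
  · refine Finset.prod_congr rfl fun i _ => ?_
    simp [Matrix.diagonal_mul]
  · intro i j (hij : j < i)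
    simp [Matrix.diagonal_mul, Matrix.one_apply_ne' (ne_of_lt hij), hK i j hij]

/-- The scalar pencil `1 + diagonal d * K` of an upper-triangular matrix `K` is upper triangular,
so its determinant is `∏ i, (1 + d i * K i i)`. [folklore] -/
theorem det_one_add_diagonal_mul_of_upperTriangular {R : ℕ} (K : Matrix (Fin R) (Fin R) ℂ)
    (d : Fin R → ℂ) (hK : ∀ i j : Fin R, j < i → K i j = 0) :
    (1 + Matrix.diagonal d * K).det = ∏ i, (1 + d i * K i i) := by
  rw [Matrix.det_of_upperTriangular]
  · refine Finset.prod_congr rfl fun i _ => ?_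
    simp [Matrix.diagonal_mul]
  · intro i j (hij : j < i)
    simp [Matrix.diagonal_mul, Matrix.one_apply_ne' (ne_of_lt hij), hK i j hij]

/-- Zero-freeness of the pencil determinant of an upper-triangular `K₀` on the closed radius-2
polydisc forces every diagonal entry to have norm `≤ 1 / 2`: otherwise the constant point
`z ≡ -(K₀ i i)⁻¹` lies in the polydisc and kills the `i`-th diagonal factor. [folklore] -/
theorem norm_diag_le_half_of_eval_ne_zero {R : ℕ} {σ : Type} (K₀ : Matrix (Fin R) (Fin R) ℂ)
    (κ : Fin R → σ) (hK₀ : ∀ i j : Fin R, j < i → K₀ i j = 0)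
    (hz : ∀ z : σ → ℂ, (∀ j, ‖z j‖ ≤ 2) →
      MvPolynomial.eval z (1 + Matrix.diagonal (fun i => MvPolynomial.X (κ i)) *
        K₀.map (fun a : ℂ => (MvPolynomial.C a : MvPolynomial σ ℂ))).det ≠ 0)
    (i : Fin R) : ‖K₀ i i‖ ≤ 1 / 2 := by
  by_contra h'
  have h : 1 / 2 < ‖K₀ i i‖ := not_le.mp h'
  have hpos : 0 < ‖K₀ i i‖ := lt_trans (by norm_num) h
  have hne : K₀ i i ≠ 0 := norm_pos_iff.mp hpos
  refine hz (fun _ => -(K₀ i i)⁻¹) (fun _ => ?_) ?_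
  · rw [norm_neg, norm_inv, inv_le_comm₀ hpos (by norm_num)]
    linarith
  · rw [Literature.Analysis.OperatorTheory.eval_det_one_add_diagonal_mul_map_C,
      det_one_add_diagonal_mul_of_upperTriangular K₀ _ hK₀]
    exact Finset.prod_eq_zero (Finset.mem_univ i) (by simp [hne])

/-- **Partial case (upper triangular) of the price of contractivity, same size.** If `K₀` is upper
triangular and the pencil determinant `det (1 + diagonal (X ∘ κ) * K₀.map C)` has no zero on the
closed radius-2 polydisc, then the same polynomial is realized, at the same size and with the same
colouring, by the diagonal matrix `K₁ := diagonal (fun i => K₀ i i)` of operator norm `≤ 1 / 2`.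
[folklore] -/
theorem stub_sameSize_upperTriangular :
    ∀ (R : ℕ) {σ : Type} (K₀ : Matrix (Fin R) (Fin R) ℂ) (κ : Fin R → σ),
      (∀ i j : Fin R, j < i → K₀ i j = 0) →
      (∀ z : σ → ℂ, (∀ j, ‖z j‖ ≤ 2) → MvPolynomial.eval z (1 + Matrix.diagonal (fun i => MvPolynomial.X (κ i)) * K₀.map (fun a : ℂ => (MvPolynomial.C a : MvPolynomial σ ℂ))).det ≠ 0) →
      ∃ (K₁ : Matrix (Fin R) (Fin R) ℂ) (κ₁ : Fin R → σ),
        ‖Matrix.toEuclideanCLM (𝕜 := ℂ) K₁‖ ≤ 1 / 2 ∧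
        (1 + Matrix.diagonal (fun i => MvPolynomial.X (κ i)) * K₀.map (fun a : ℂ => (MvPolynomial.C a : MvPolynomial σ ℂ))).det =
          (1 + Matrix.diagonal (fun i => MvPolynomial.X (κ₁ i)) * K₁.map (fun a : ℂ => (MvPolynomial.C a : MvPolynomial σ ℂ))).det := by
  intro R σ K₀ κ hK₀ hz
  refine ⟨Matrix.diagonal (fun i => K₀ i i), κ, ?_, ?_⟩
  · rw [Matrix.l2_opNorm_toEuclideanCLM, Matrix.l2_opNorm_diagonal]
    exact (pi_norm_le_iff_of_nonneg (by norm_num)).mpr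
      (norm_diag_le_half_of_eval_ne_zero K₀ κ hK₀ hz)
  · rw [det_pencil_of_upperTriangular K₀ κ hK₀, det_pencil_of_upperTriangular _ κ
      (fun i j hij => Matrix.diagonal_apply_ne _ (ne_of_gt hij))]
    simp [Matrix.diagonal_apply_eq]

end Summit.ValiantsHypothesis.ValiantsHypothesis.Theorems.PriceOfContractivity.UpperTriangular
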